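import Summits.ABC.IUTFork.Thm311RealInd1StripPacketThetaJunctionResidue
import Literature.IUT.LogVolume.GenuineLogThetaUnionTameContent
import Literature.IUT.LogVolume.GenuineLogThetaUnionSubIndeterminacy
import HarnessLib

/-!
# [IUTchIII] Thm 3.11 (i) (Ind1)+(Ind2) ⟶ Cor 3.12, READING (U) (the hull of the UNION of the possible images — the cell's reading of record):
# THE UNION JUNCTION — modulo `JannsenWingbergMappingClass`, at a genuine place-section packet all of whose factors are tame of odd local degree
# `≥ 3` with residue degree `≠ 1`, the `(R_I)^∼`-hull of the orbit of the (Ind1)-slot-union region `⋃_σ σ·O_𝕃(−P_Θ)_{v⃗∘σ} = ⋃_a ι_a(t_{i,v_a})·(R_I)^∼`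
# under ANY sub-indeterminacy of the Dupuy–Hilado container containing print's single-factor (Ind1) strip moves EQUALS the hull of ALL possible images;
# hence reading (U) computed over print's (Ind1)⊔(Ind2) AS TYPED is the container's `−|log(Θ)|_p`

PROOF-ONLY file (abc-iut cell, Cor. 3.12 sub-crew, seat abc-iut-c312-1 = holder of record of the typed [IUTchIII] Thm. 3.11, gens 16–17, row «R23 C:UNION-JUNCTION»; reading-(U) twin of
rows R21/R22: `Thm311RealInd1StripPacketThetaJunction{,Volume,Residue}` p538494 / p539517 / p541705 and `GenuineLogThetaPerImageTameContent` p540946).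
TAKES NO SIDE on [IUTchIII] Cor. 3.12.  No definition, no `Prop` fact; `JannsenWingbergMappingClass` is the only conditional input (binder `hMC`).

* §1 packet level **`packetHull_iUnion_image_iUnion_iota_smul_normalizedPacket_eq_of_jannsenWingbergMappingClass`** — genuine packet `⊗_i K_{w_i}`, every
  factor TAME of ODD local degree `≥ 3` with `f ≠ 1`, slot elements `‖g_a‖ = p^{−v_a/e_a}`; for every `H ≤ indTwo` containing the single-factor strip moves:
  `packetHull(⋃_{γ ∈ H} γ(⋃_a ι_a(g_a)·(R_I)^∼)) = packetHull(p^{min_a A_a}·log_p(R_I^×))`, `A_a = (v_a − 1) div e_a + 1 − |I|` — UPPER: the slot union lies in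
  `p^{min A}·L` (`TameContent.content_iUnion_iota_smul_normalizedPacket`, UNCONDITIONAL) which the container preserves (R21 file 1
  `packetHull_iUnion_image_subset_of_subset_smul_logPacket`); LOWER: R21 file 1's print-side core `packetHull_iUnion_image_iota_smul_normalizedPacket_eq_…`
  AT THE MINIMISING SLOT `a₀` (the `H`-orbit of the single twist `ι_{a₀}(g_{a₀})·(R_I)^∼ ⊆` the union already has hull `packetHull(p^{A_{a₀}}·L)`).
* §2 place-section level **`localFields_packetHull_orbitH_indOneUnion_pilotRegion_eq_possibleImagesHull_of_jannsenWingbergMappingClass`** — in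
  abc-iut-c312-d1's reading-(U) `H`-shape (`GenuineLogThetaUnionSubIndeterminacy`: the `H`-orbit of `⋃_σ perm_σ(O_𝕃(−P_Θ)_{v⃗∘σ})`): its
  `(R_I)^∼`-hull EQUALS `possibleImagesHull` (c312-3 `realPrimePacketWith_possibleImages_pilotRegion_eq` / `…indOneUnion_pilotRegion_eq_slotUnion`;
  container side = `GenuineLogThetaUnionTameContent`, this seat).
* §1/§2 EXACT RESIDUE FORMS **`…_of_residue_of_jannsenWingbergMappingClass`** (row R22 (β)'s shape, p541705): R21's «`f ≠ 1` at every factor»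
  WEAKENED to — at a named content-minimising slot `a₀` — `f ≠ 1` at the RAMIFIED factors `b ≠ a₀` and, at `a₀`, only when `e(v̲_{a₀}|p) ∣ v_{a₀}`.
* §3 **`localFields_lnνLp_hull_orbitH_indOneUnion_eq_negLogThetaAt_of_jannsenWingbergMappingClass`** — when EVERY `v̲ ∣ p` of the section is tame of odd
  local degree `≥ 3` with `f ≠ 1`: `ln ν̄_{𝕃_p}(v⃗ ↦ hull(⋃_{g ∈ H_{v⃗}} g(⋃_σ σ·O_𝕃(−P_Θ)_{v⃗∘σ}))) = −|log(Θ)|_p` (`negLogThetaAt`, READING (U) — the hull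
  of the union of ALL possible images, [IUTchIII] Cor. 3.12 p. 174 as the cell reads it); input level `ThetaVolumeInput.lnνLp_hull_orbitH_indOneUnion_eq_negLogThetaLoc_…`.
  With c312-d1's (U)-monotonicity (`realPrimePacketWith_lnνLp_hull_orbitH_slotUnion_le_negLogThetaAt`, p503854) and this lineage's R17a-U (p517906): at
  such primes the Θ-side of reading (U) over print's (Ind1)⊔(Ind2) AS TYPED is PINNED to the container's, so the cells of record for `Cor312Of` transfer
  verbatim there.
HONEST SCOPE as in R21/R22: OUR typings (THE equivariant lift, THE logarithm, factorwise action; (Ind1) = factor permutations + the strip part as typed;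
F-B28-1 untouched); conditional on `hMC`; residues `f = 1` (exact form: `…Residue`), even local degree (NOT typed), wild, `p = 2`; equal-AS-TYPED ≠
equal in print; nothing here asserts that abc is proved or refuted; no side taken. [claim: Mochizuki2012, status: disputed]; [cite: Mochizuki2012,
IUTchIII Thm. 3.11 (i) p. 154; Cor. 3.12 p. 174, proof Steps (x)/(xi) pp. 180–183; IUTchIV Prop. 1.2 (ii) p. 10–11]; [cite: Kondo2025OuterAutMLF, §3 Thm 3.17,
Rem 3.18]; [cite: DupuyHilado2025, §4.7, §4.9, §4.11, §4.12]. typed ≠ proved; a conditional theorem discharges nothing it binds.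
-/

set_option autoImplicit false

noncomputable section

open Metric Set Function
open scoped Pointwise TensorProduct

namespace Summit.ABC.IUTFork.Thm311.Real

open NumberField IsDedekindDomain Literature.NumberTheory.NumberFields Literature.IUT.LogVolume
open Literature.NumberTheory.GaloisRepresentations Literature.NumberTheory.GaloisRepresentations.Ultrametric
open Literature.AnabelianGeometry.AbsoluteAnabelian Literature.IUT.HodgeArakelov
open Literature.IUT.HodgeArakelov.AbsTopMonoids

/-! ## §1 Packet level: the `H`-orbit of the slot union -/

section GenuineFactors

variable {K : Type} [Field K] [NumberField K] (p : ℕ) [hp : Fact p.Prime]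
variable {I : Type} [Fintype I] [DecidableEq I] (w : I → HeightOneSpectrum (𝓞 K)) (hw : ∀ i, ((p : ℕ) : 𝓞 K) ∈ (w i).asIdeal)

/-- **THE UNION JUNCTION at the packet (modulo `JannsenWingbergMappingClass`).**  Genuine packet `X = ⊗_i K_{w_i}`, every factor TAME of ODD local degree
`≥ 3` with residue degree `≠ 1`; slot elements `g_a` with `‖g_a‖ = p^{−v_a/e_a}`; `H ≤ indTwo` containing the single-factor (Ind1) strip moves.  Then
`packetHull(⋃_{γ ∈ H} γ(⋃_a ι_a(g_a)·(R_I)^∼)) = packetHull(p^{min_a A_a}·log_p(R_I^×))`, `A_a = (v_a − 1) div e_a + 1 − |I|`: upper by the content of the slot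
union (container side, unconditional), lower by R21's print-side core at the minimising slot. [claim: Mochizuki2012, status: disputed]
[cite: Mochizuki2012, IUTchIII Thm. 3.11 (i) p. 154; Cor. 3.12 p. 174; IUTchIV Prop. 1.2 (ii) p. 10–11] [cite: Kondo2025OuterAutMLF, §3 Thm 3.17, Rem 3.18]
[cite: DupuyHilado2025, §4.7, §4.9, §4.12] -/
theorem packetHull_iUnion_image_iUnion_iota_smul_normalizedPacket_eq_of_jannsenWingbergMappingClass [Nonempty I]
    (hMC : JannsenWingbergMappingClass) (hp2 : 2 < p)
    (he : ∀ i, absRamificationIdx p (RescaledCompletion K p (w i) (hw i)) ≤ p - 2)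
    (h3 : ∀ i, 3 ≤ localDeg K (w i)) (hodd : ∀ i, Odd (localDeg K (w i))) (hf : ∀ i, (w i).asIdeal.inertiaDeg ℤ ≠ 1)
    (g : Π i, RescaledCompletion K p (w i) (hw i)) (v : I → ℤ)
    (hg : ∀ i, ‖g i‖ = (p : ℝ) ^ (-(v i / (absRamificationIdx p (RescaledCompletion K p (w i) (hw i)) : ℝ))))
    (H : Subgroup (PacketAlgebra p (fun i => RescaledCompletion K p (w i) (hw i)) ≃ₗ[ℚ_[p]]
      PacketAlgebra p (fun i => RescaledCompletion K p (w i) (hw i))))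
    (hH : H ≤ indTwo p (fun i => RescaledCompletion K p (w i) (hw i)))
    (hstrip : ∀ (i₁ : I), ∀ ψ ∈ ind1StripOf (w i₁) (galoisLog (w i₁)), ∃ γ ∈ H,
      ∀ z : Π i, RescaledCompletion K p (w i) (hw i),
        (γ : PacketAlgebra p (fun i => RescaledCompletion K p (w i) (hw i)) ≃ₗ[ℚ_[p]]
            PacketAlgebra p (fun i => RescaledCompletion K p (w i) (hw i))) (PiTensorProduct.tprod ℚ_[p] z) =
          PiTensorProduct.tprod ℚ_[p] (update z i₁ (RescaledCompletion.of K p (w i₁) (hw i₁)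
            (ψ ((RescaledCompletion.of K p (w i₁) (hw i₁)).symm (z i₁)))))) :
    packetHull p (fun i => RescaledCompletion K p (w i) (hw i))
        (⋃ γ : H, (γ : PacketAlgebra p (fun i => RescaledCompletion K p (w i) (hw i)) ≃ₗ[ℚ_[p]]
            PacketAlgebra p (fun i => RescaledCompletion K p (w i) (hw i))) ''
          ⋃ a, iota p (fun i => RescaledCompletion K p (w i) (hw i)) a (g a) •
            (normalizedPacket p (fun i => RescaledCompletion K p (w i) (hw i)) :
              Set (PacketAlgebra p (fun i => RescaledCompletion K p (w i) (hw i))))) =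
      packetHull p (fun i => RescaledCompletion K p (w i) (hw i))
        (((p : ℚ_[p]) ^ (Finset.univ.inf' Finset.univ_nonempty
            (fun a => (v a - 1) / (absRamificationIdx p (RescaledCompletion K p (w a) (hw a)) : ℤ) + 1 - Fintype.card I))) •
          (logPacket p (fun i => RescaledCompletion K p (w i) (hw i)) :
            Set (PacketAlgebra p (fun i => RescaledCompletion K p (w i) (hw i))))) := by
  set k := fun i => RescaledCompletion K p (w i) (hw i) with hk
  set A : I → ℤ := fun a => (v a - 1) / (absRamificationIdx p (k a) : ℤ) + 1 - Fintype.card I with hA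
  obtain ⟨hsub, -⟩ := TameContent.content_iUnion_iota_smul_normalizedPacket p k hp2 he g v hg
  refine Set.Subset.antisymm (packetHull_iUnion_image_subset_of_subset_smul_logPacket p k hsub H hH) ?_
  -- lower bound at the minimising slot
  obtain ⟨a₀, -, ha₀⟩ := Finset.exists_mem_eq_inf' Finset.univ_nonempty A
  have hcore := packetHull_iUnion_image_iota_smul_normalizedPacket_eq_of_jannsenWingbergMappingClass p w hw hMC hp2 he h3 hodd hf a₀
    (hg a₀) H hH hstrip
  change packetHull p k (((p : ℚ_[p]) ^ (Finset.univ.inf' Finset.univ_nonempty A)) • (logPacket p k : Set (PacketAlgebra p k))) ⊆ _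
  rw [ha₀, ← hcore]
  refine packetHull_mono p k (Set.iUnion_mono fun γ => Set.image_mono ?_)
  exact Set.subset_iUnion (fun a => iota p k a (g a) • (normalizedPacket p k : Set (PacketAlgebra p k))) a₀

/-- **THE UNION JUNCTION at the packet, EXACT RESIDUE FORM (modulo `JannsenWingbergMappingClass`).**  Setting of
`packetHull_iUnion_image_iUnion_iota_smul_normalizedPacket_eq_of_jannsenWingbergMappingClass`, with R21's «residue degree `≠ 1` at EVERY factor»
WEAKENED to the hypothesis the single-place floors consume at ONE content-minimising slot `a₀` (`(v_{a₀} − 1) div e_{a₀} ≤ (v_a − 1) div e_a` for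
every `a`; the exponent `min_a A_a` is attained there): residue degree `1` (such a factor is RAMIFIED, by `localDeg ≥ 3`) is allowed only AT the
factor `a₀`, and there only when `e_{a₀} ∤ v_{a₀}` (`hres`, the shape of row R22 (β)
`packetHull_iUnion_image_iota_smul_normalizedPacket_eq_of_residue_of_jannsenWingbergMappingClass`, p541705).  Same conclusion; the `f ≠ 1` version
above is the case `hres` vacuous. [claim: Mochizuki2012, status: disputed]
[cite: Mochizuki2012, IUTchIII Thm. 3.11 (i) p. 154; Cor. 3.12 p. 174; IUTchIV Prop. 1.2 (ii) p. 10–11] [cite: Kondo2025OuterAutMLF, §3 Thm 3.17, Rem 3.18]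
[cite: DupuyHilado2025, §4.7, §4.9, §4.12] -/
theorem packetHull_iUnion_image_iUnion_iota_smul_normalizedPacket_eq_of_residue_of_jannsenWingbergMappingClass [Nonempty I]
    (hMC : JannsenWingbergMappingClass) (hp2 : 2 < p)
    (he : ∀ i, absRamificationIdx p (RescaledCompletion K p (w i) (hw i)) ≤ p - 2)
    (h3 : ∀ i, 3 ≤ localDeg K (w i)) (hodd : ∀ i, Odd (localDeg K (w i)))
    (g : Π i, RescaledCompletion K p (w i) (hw i)) (v : I → ℤ)
    (hg : ∀ i, ‖g i‖ = (p : ℝ) ^ (-(v i / (absRamificationIdx p (RescaledCompletion K p (w i) (hw i)) : ℝ))))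
    (a₀ : I)
    (ha₀ : ∀ a, (v a₀ - 1) / (absRamificationIdx p (RescaledCompletion K p (w a₀) (hw a₀)) : ℤ) ≤
      (v a - 1) / (absRamificationIdx p (RescaledCompletion K p (w a) (hw a)) : ℤ))
    (hres : ∀ i, (w i).asIdeal.inertiaDeg ℤ = 1 →
      i = a₀ ∧ ¬ ((absRamificationIdx p (RescaledCompletion K p (w a₀) (hw a₀)) : ℤ) ∣ v a₀))
    (H : Subgroup (PacketAlgebra p (fun i => RescaledCompletion K p (w i) (hw i)) ≃ₗ[ℚ_[p]]
      PacketAlgebra p (fun i => RescaledCompletion K p (w i) (hw i))))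
    (hH : H ≤ indTwo p (fun i => RescaledCompletion K p (w i) (hw i)))
    (hstrip : ∀ (i₁ : I), ∀ ψ ∈ ind1StripOf (w i₁) (galoisLog (w i₁)), ∃ γ ∈ H,
      ∀ z : Π i, RescaledCompletion K p (w i) (hw i),
        (γ : PacketAlgebra p (fun i => RescaledCompletion K p (w i) (hw i)) ≃ₗ[ℚ_[p]]
            PacketAlgebra p (fun i => RescaledCompletion K p (w i) (hw i))) (PiTensorProduct.tprod ℚ_[p] z) =
          PiTensorProduct.tprod ℚ_[p] (update z i₁ (RescaledCompletion.of K p (w i₁) (hw i₁)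
            (ψ ((RescaledCompletion.of K p (w i₁) (hw i₁)).symm (z i₁)))))) :
    packetHull p (fun i => RescaledCompletion K p (w i) (hw i))
        (⋃ γ : H, (γ : PacketAlgebra p (fun i => RescaledCompletion K p (w i) (hw i)) ≃ₗ[ℚ_[p]]
            PacketAlgebra p (fun i => RescaledCompletion K p (w i) (hw i))) ''
          ⋃ a, iota p (fun i => RescaledCompletion K p (w i) (hw i)) a (g a) •
            (normalizedPacket p (fun i => RescaledCompletion K p (w i) (hw i)) :
              Set (PacketAlgebra p (fun i => RescaledCompletion K p (w i) (hw i))))) =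
      packetHull p (fun i => RescaledCompletion K p (w i) (hw i))
        (((p : ℚ_[p]) ^ (Finset.univ.inf' Finset.univ_nonempty
            (fun a => (v a - 1) / (absRamificationIdx p (RescaledCompletion K p (w a) (hw a)) : ℤ) + 1 - Fintype.card I))) •
          (logPacket p (fun i => RescaledCompletion K p (w i) (hw i)) :
            Set (PacketAlgebra p (fun i => RescaledCompletion K p (w i) (hw i))))) := by
  set k := fun i => RescaledCompletion K p (w i) (hw i) with hk
  set A : I → ℤ := fun a => (v a - 1) / (absRamificationIdx p (k a) : ℤ) + 1 - Fintype.card I with hA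
  obtain ⟨hsub, -⟩ := TameContent.content_iUnion_iota_smul_normalizedPacket p k hp2 he g v hg
  refine Set.Subset.antisymm (packetHull_iUnion_image_subset_of_subset_smul_logPacket p k hsub H hH) ?_
  -- the named slot `a₀` attains the minimum content
  have hmin : Finset.univ.inf' Finset.univ_nonempty A = A a₀ :=
    le_antisymm (Finset.inf'_le A (Finset.mem_univ a₀))
      (Finset.le_inf' Finset.univ_nonempty A fun a _ => by
        have := ha₀ a
        simp only [hA]
        linarith)
  have hcore := packetHull_iUnion_image_iota_smul_normalizedPacket_eq_of_residue_of_jannsenWingbergMappingClass p w hw hMC hp2 he h3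
    hodd a₀ (hg a₀) hres H hH hstrip
  change packetHull p k (((p : ℚ_[p]) ^ (Finset.univ.inf' Finset.univ_nonempty A)) • (logPacket p k : Set (PacketAlgebra p k))) ⊆ _
  rw [hmin, ← hcore]
  refine packetHull_mono p k (Set.iUnion_mono fun γ => Set.image_mono ?_)
  exact Set.subset_iUnion (fun a => iota p k a (g a) • (normalizedPacket p k : Set (PacketAlgebra p k))) a₀

end GenuineFactors

/-! ## §2 Place-section level: the `H`-orbit of the (Ind1)-slot union of `O_𝕃(−P_Θ)` -/

section PlaceSection

variable {F₀ : Type} [Field F₀] [NumberField F₀] {K : Type} [Field K] [NumberField K] [Algebra F₀ K]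
variable (σ : PlaceSection F₀ K) (p : ℕ) [hp : Fact p.Prime]
variable (c : (j : ℕ) → (Fin (j + 1) → placesOver F₀ p) → ℚ_[p]) (hc0 : ∀ j e, c j e ≠ 0)
  (hcσ : ∀ (j : ℕ) (τ : Equiv.Perm (Fin (j + 1))) (e : Fin (j + 1) → placesOver F₀ p), c j (e ∘ τ) = c j e)

/-- **THE UNION JUNCTION (modulo `JannsenWingbergMappingClass`).**  Real prime packet over the GENUINE completions of a place section (any shell
normalisation), Θ-idele `t`, degree `j = i+1`, collection `v⃗ = e` with every factor TAME of ODD local degree `≥ 3` and residue degree `≠ 1`.  For every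
subgroup `H` of the packet automorphisms INSIDE the Dupuy–Hilado container that CONTAINS the single-factor (Ind1) strip moves: the `(R_I)^∼`-hull of the
`H`-orbit of the (Ind1)-slot union `⋃_σ σ·O_𝕃(−P_Θ)_{v⃗∘σ}` EQUALS the hull of the union of ALL possible images (reading (U)'s region).
[claim: Mochizuki2012, status: disputed] [cite: Mochizuki2012, IUTchIII Thm. 3.11 (i) p. 154; Cor. 3.12 p. 174; IUTchIV Prop. 1.2 (ii) p. 10–11]
[cite: Kondo2025OuterAutMLF, §3 Thm 3.17, Rem 3.18] [cite: DupuyHilado2025, §4.7, §4.9, §4.11, §4.12] -/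
theorem localFields_packetHull_orbitH_indOneUnion_pilotRegion_eq_possibleImagesHull_of_jannsenWingbergMappingClass
    (hMC : JannsenWingbergMappingClass) (hp2 : 2 < p) {lstar : ℕ}
    (t : Fin lstar → (v : placesOver F₀ p) → ((σ.localFields p).k v)ˣ) (i : Fin lstar)
    (e : Fin ((i : ℕ) + 1 + 1) → placesOver F₀ p)
    (he : ∀ b, absRamificationIdx p ((σ.localFields p).k (e b)) ≤ p - 2)
    (h3 : ∀ b, 3 ≤ localDeg K (σ.lift (e b).1)) (hodd : ∀ b, Odd (localDeg K (σ.lift (e b).1)))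
    (hf : ∀ b, (σ.lift (e b).1).asIdeal.inertiaDeg ℤ ≠ 1)
    (H : Subgroup (PacketAlgebra p (fun b => (σ.localFields p).k (e b)) ≃ₗ[ℚ_[p]]
      PacketAlgebra p (fun b => (σ.localFields p).k (e b))))
    (hH : H ≤ indTwo p (fun b => (σ.localFields p).k (e b)))
    (hstrip : ∀ (b₀ : Fin ((i : ℕ) + 1 + 1)),
      ∀ ψ ∈ ind1StripOf (σ.lift (e b₀).1) (galoisLog (σ.lift (e b₀).1)), ∃ γ ∈ H,
        ∀ z : ∀ b, (σ.localFields p).k (e b),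
          (γ : PacketAlgebra p (fun b => (σ.localFields p).k (e b)) ≃ₗ[ℚ_[p]]
              PacketAlgebra p (fun b => (σ.localFields p).k (e b))) (PiTensorProduct.tprod ℚ_[p] z) =
            PiTensorProduct.tprod ℚ_[p] (update z b₀
              (RescaledCompletion.of K p (σ.lift (e b₀).1) (σ.natCast_mem_lift (e b₀))
                (ψ ((RescaledCompletion.of K p (σ.lift (e b₀).1) (σ.natCast_mem_lift (e b₀))).symm (z b₀)))))) :
    packetHull p (fun b => (σ.localFields p).k (e b))
        (⋃ γ : H, (γ : PacketAlgebra p (fun b => (σ.localFields p).k (e b)) ≃ₗ[ℚ_[p]]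
            PacketAlgebra p (fun b => (σ.localFields p).k (e b))) ''
          ⋃ τ : Equiv.Perm (Fin ((i : ℕ) + 1 + 1)), (realPrimePacketWith p (σ.localFields p) c hc0 hcσ).perm τ e ''
            (realPrimePacketWith p (σ.localFields p) c hc0 hcσ).pilotRegion t ((i : ℕ) + 1) (e ∘ τ)) =
      (realPrimePacketWith p (σ.localFields p) c hc0 hcσ).possibleImagesHull
        ((realPrimePacketWith p (σ.localFields p) c hc0 hcσ).pilotRegion t) ((i : ℕ) + 1) e := by
  -- slot valuations
  have hval := fun a : Fin ((i : ℕ) + 1 + 1) =>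
    exists_norm_eq_rpow p ((σ.localFields p).k (e a)) (t i (e a)).ne_zero
  choose v hv using hval
  have hcore := packetHull_iUnion_image_iUnion_iota_smul_normalizedPacket_eq_of_jannsenWingbergMappingClass p
    (fun b => σ.lift (e b).1) (fun b => σ.natCast_mem_lift (e b)) hMC hp2 he h3 hodd hf
    (fun a => (t i (e a) : (σ.localFields p).k (e a))) v hv H hH hstrip
  have hcont := TameContent.packetHull_orbit_iUnion_iota_smul_normalizedPacket_eq p (fun b => (σ.localFields p).k (e b)) hp2 he
    (fun a => (t i (e a) : (σ.localFields p).k (e a))) v hv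
  have hU : (⋃ τ : Equiv.Perm (Fin ((i : ℕ) + 1 + 1)),
      ((realPrimePacketWith p (σ.localFields p) c hc0 hcσ).perm τ e ''
          (realPrimePacketWith p (σ.localFields p) c hc0 hcσ).pilotRegion t ((i : ℕ) + 1) (e ∘ τ) :
        Set (PacketAlgebra p (fun b => (σ.localFields p).k (e b))))) =
      ⋃ a : Fin ((i : ℕ) + 1 + 1), iota p (fun b => (σ.localFields p).k (e b)) a (t i (e a) : (σ.localFields p).k (e a)) •
        (normalizedPacket p (fun b => (σ.localFields p).k (e b)) : Set (PacketAlgebra p (fun b => (σ.localFields p).k (e b)))) :=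
    realPrimePacketWith_indOneUnion_pilotRegion_eq_slotUnion p (σ.localFields p) c hc0 hcσ t i e
  change packetHull p _ (⋃ γ : H, (γ : PacketAlgebra p (fun b => (σ.localFields p).k (e b)) ≃ₗ[ℚ_[p]]
      PacketAlgebra p (fun b => (σ.localFields p).k (e b))) '' ⋃ τ : Equiv.Perm (Fin ((i : ℕ) + 1 + 1)),
      ((realPrimePacketWith p (σ.localFields p) c hc0 hcσ).perm τ e ''
          (realPrimePacketWith p (σ.localFields p) c hc0 hcσ).pilotRegion t ((i : ℕ) + 1) (e ∘ τ) :
        Set (PacketAlgebra p (fun b => (σ.localFields p).k (e b))))) =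
    packetHull p _ ((realPrimePacketWith p (σ.localFields p) c hc0 hcσ).possibleImages _ _ e)
  rw [hU, realPrimePacketWith_possibleImages_pilotRegion_eq]
  exact hcore.trans hcont.symm

/-- **THE UNION JUNCTION, EXACT RESIDUE FORM (modulo `JannsenWingbergMappingClass`).**  Setting of
`localFields_packetHull_orbitH_indOneUnion_pilotRegion_eq_possibleImagesHull_of_jannsenWingbergMappingClass`, with the slot valuations
`‖t_{i,v_a}‖ = p^{−v_a/e(v̲_a|p)}` displayed, a content-minimising slot `a₀` named (`(v_{a₀} − 1) div e(v̲_{a₀}|p) ≤ (v_a − 1) div e(v̲_a|p)` for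
every `a`), and R21's «residue degree `≠ 1` at every factor» WEAKENED to: residue degree `≠ 1` at the RAMIFIED factors `b ≠ a₀` (`hram`; at an
unramified factor it is automatic from `localDeg ≥ 3`), and at `a₀` only when `e(v̲_{a₀}|p) ∣ v_{a₀}` (`hmin`) — the union analogue of row R22 (β)
`localFields_packetHull_orbitH_pilotRegion_eq_slotImagesHull_of_residue_of_jannsenWingbergMappingClass` (p541705).  Same conclusion: the
`(R_I)^∼`-hull of the `H`-orbit of the (Ind1)-slot union EQUALS the hull of ALL possible images. [claim: Mochizuki2012, status: disputed]
[cite: Mochizuki2012, IUTchIII Thm. 3.11 (i) p. 154; Cor. 3.12 p. 174; IUTchIV Prop. 1.2 (ii) p. 10–11] [cite: Kondo2025OuterAutMLF, §3 Thm 3.17, Rem 3.18]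
[cite: DupuyHilado2025, §4.7, §4.9, §4.11, §4.12] -/
theorem localFields_packetHull_orbitH_indOneUnion_pilotRegion_eq_possibleImagesHull_of_residue_of_jannsenWingbergMappingClass
    (hMC : JannsenWingbergMappingClass) (hp2 : 2 < p) {lstar : ℕ}
    (t : Fin lstar → (v : placesOver F₀ p) → ((σ.localFields p).k v)ˣ) (i : Fin lstar)
    (e : Fin ((i : ℕ) + 1 + 1) → placesOver F₀ p)
    (he : ∀ b, absRamificationIdx p ((σ.localFields p).k (e b)) ≤ p - 2)
    (h3 : ∀ b, 3 ≤ localDeg K (σ.lift (e b).1)) (hodd : ∀ b, Odd (localDeg K (σ.lift (e b).1)))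
    (v : Fin ((i : ℕ) + 1 + 1) → ℤ)
    (hv : ∀ a, ‖(t i (e a) : (σ.localFields p).k (e a))‖ =
      (p : ℝ) ^ (-(v a / (absRamificationIdx p ((σ.localFields p).k (e a)) : ℝ))))
    (a₀ : Fin ((i : ℕ) + 1 + 1))
    (ha₀ : ∀ a, (v a₀ - 1) / (absRamificationIdx p ((σ.localFields p).k (e a₀)) : ℤ) ≤
      (v a - 1) / (absRamificationIdx p ((σ.localFields p).k (e a)) : ℤ))
    (hram : ∀ b, b ≠ a₀ → absRamificationIdx p ((σ.localFields p).k (e b)) ≠ 1 →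
      (σ.lift (e b).1).asIdeal.inertiaDeg ℤ ≠ 1)
    (hmin : (σ.lift (e a₀).1).asIdeal.inertiaDeg ℤ = 1 →
      ¬ ((absRamificationIdx p ((σ.localFields p).k (e a₀)) : ℤ) ∣ v a₀))
    (H : Subgroup (PacketAlgebra p (fun b => (σ.localFields p).k (e b)) ≃ₗ[ℚ_[p]]
      PacketAlgebra p (fun b => (σ.localFields p).k (e b))))
    (hH : H ≤ indTwo p (fun b => (σ.localFields p).k (e b)))
    (hstrip : ∀ (b₀ : Fin ((i : ℕ) + 1 + 1)),
      ∀ ψ ∈ ind1StripOf (σ.lift (e b₀).1) (galoisLog (σ.lift (e b₀).1)), ∃ γ ∈ H,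
        ∀ z : ∀ b, (σ.localFields p).k (e b),
          (γ : PacketAlgebra p (fun b => (σ.localFields p).k (e b)) ≃ₗ[ℚ_[p]]
              PacketAlgebra p (fun b => (σ.localFields p).k (e b))) (PiTensorProduct.tprod ℚ_[p] z) =
            PiTensorProduct.tprod ℚ_[p] (update z b₀
              (RescaledCompletion.of K p (σ.lift (e b₀).1) (σ.natCast_mem_lift (e b₀))
                (ψ ((RescaledCompletion.of K p (σ.lift (e b₀).1) (σ.natCast_mem_lift (e b₀))).symm (z b₀)))))) :
    packetHull p (fun b => (σ.localFields p).k (e b))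
        (⋃ γ : H, (γ : PacketAlgebra p (fun b => (σ.localFields p).k (e b)) ≃ₗ[ℚ_[p]]
            PacketAlgebra p (fun b => (σ.localFields p).k (e b))) ''
          ⋃ τ : Equiv.Perm (Fin ((i : ℕ) + 1 + 1)), (realPrimePacketWith p (σ.localFields p) c hc0 hcσ).perm τ e ''
            (realPrimePacketWith p (σ.localFields p) c hc0 hcσ).pilotRegion t ((i : ℕ) + 1) (e ∘ τ)) =
      (realPrimePacketWith p (σ.localFields p) c hc0 hcσ).possibleImagesHull
        ((realPrimePacketWith p (σ.localFields p) c hc0 hcσ).pilotRegion t) ((i : ℕ) + 1) e := by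
  have hres := residue_of_ramified p (fun b => σ.lift (e b).1) (fun b => σ.natCast_mem_lift (e b)) h3 a₀ (v a₀) hram hmin
  have hcore := packetHull_iUnion_image_iUnion_iota_smul_normalizedPacket_eq_of_residue_of_jannsenWingbergMappingClass p
    (fun b => σ.lift (e b).1) (fun b => σ.natCast_mem_lift (e b)) hMC hp2 he h3 hodd
    (fun a => (t i (e a) : (σ.localFields p).k (e a))) v hv a₀ ha₀ hres H hH hstrip
  have hcont := TameContent.packetHull_orbit_iUnion_iota_smul_normalizedPacket_eq p (fun b => (σ.localFields p).k (e b)) hp2 he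
    (fun a => (t i (e a) : (σ.localFields p).k (e a))) v hv
  have hU : (⋃ τ : Equiv.Perm (Fin ((i : ℕ) + 1 + 1)),
      ((realPrimePacketWith p (σ.localFields p) c hc0 hcσ).perm τ e ''
          (realPrimePacketWith p (σ.localFields p) c hc0 hcσ).pilotRegion t ((i : ℕ) + 1) (e ∘ τ) :
        Set (PacketAlgebra p (fun b => (σ.localFields p).k (e b))))) =
      ⋃ a : Fin ((i : ℕ) + 1 + 1), iota p (fun b => (σ.localFields p).k (e b)) a (t i (e a) : (σ.localFields p).k (e a)) •
        (normalizedPacket p (fun b => (σ.localFields p).k (e b)) : Set (PacketAlgebra p (fun b => (σ.localFields p).k (e b)))) :=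
    realPrimePacketWith_indOneUnion_pilotRegion_eq_slotUnion p (σ.localFields p) c hc0 hcσ t i e
  change packetHull p _ (⋃ γ : H, (γ : PacketAlgebra p (fun b => (σ.localFields p).k (e b)) ≃ₗ[ℚ_[p]]
      PacketAlgebra p (fun b => (σ.localFields p).k (e b))) '' ⋃ τ : Equiv.Perm (Fin ((i : ℕ) + 1 + 1)),
      ((realPrimePacketWith p (σ.localFields p) c hc0 hcσ).perm τ e ''
          (realPrimePacketWith p (σ.localFields p) c hc0 hcσ).pilotRegion t ((i : ℕ) + 1) (e ∘ τ) :
        Set (PacketAlgebra p (fun b => (σ.localFields p).k (e b))))) =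
    packetHull p _ ((realPrimePacketWith p (σ.localFields p) c hc0 hcσ).possibleImages _ _ e)
  rw [hU, realPrimePacketWith_possibleImages_pilotRegion_eq]
  exact hcore.trans hcont.symm

/-! ## §3 The `ln ν̄_{𝕃_p}`-level identity with `−|log(Θ)|_p` (reading (U)) -/

/-- **READING (U) OVER PRINT's (Ind1)⊔(Ind2) AS TYPED EQUALS `−|log(Θ)|_p` (modulo `JannsenWingbergMappingClass`; tame, odd local degree `≥ 3`, `f ≠ 1` at
every place of the section over `p`).**  For the real prime packet over the genuine completions of a place section (any shell normalisation `c`), a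
Θ-idele `t`, and any family `H = (H_{j,v⃗})` of subgroups of the packet automorphisms with `H_{j,v⃗} ≤ indTwo` containing the single-factor (Ind1) strip moves
in the degrees `j = i+1 ≤ ℓ⋆`: `ln ν̄_{𝕃_p}(v⃗ ↦ hull(⋃_{g ∈ H_{v⃗}} g(⋃_σ σ·O_𝕃(−P_Θ)_{v⃗∘σ}))) = −|log(Θ)|_p` (c312-3's `negLogThetaAt`: the hull of the union
of ALL possible images). [claim: Mochizuki2012, status: disputed] [cite: Mochizuki2012, IUTchIII Thm. 3.11 (i) p. 154; Cor. 3.12 p. 174]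
[cite: Kondo2025OuterAutMLF, §3 Thm 3.17, Rem 3.18] [cite: DupuyHilado2025, §4.7, §4.9, §4.11, §4.12] -/
theorem localFields_lnνLp_hull_orbitH_indOneUnion_eq_negLogThetaAt_of_jannsenWingbergMappingClass
    (hMC : JannsenWingbergMappingClass) (hp2 : 2 < p) {lstar : ℕ}
    (t : Fin lstar → (v : placesOver F₀ p) → ((σ.localFields p).k v)ˣ)
    (he : ∀ v : placesOver F₀ p, absRamificationIdx p ((σ.localFields p).k v) ≤ p - 2)
    (h3 : ∀ v : placesOver F₀ p, 3 ≤ localDeg K (σ.lift v.1)) (hodd : ∀ v : placesOver F₀ p, Odd (localDeg K (σ.lift v.1)))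
    (hf : ∀ v : placesOver F₀ p, (σ.lift v.1).asIdeal.inertiaDeg ℤ ≠ 1)
    (H : (j : ℕ) → (e : Fin (j + 1) → placesOver F₀ p) →
      Subgroup (PacketAlgebra p (fun b => (σ.localFields p).k (e b)) ≃ₗ[ℚ_[p]]
        PacketAlgebra p (fun b => (σ.localFields p).k (e b))))
    (hH : ∀ j e, H j e ≤ indTwo p (fun b => (σ.localFields p).k (e b)))
    (hstrip : ∀ (i : Fin lstar) (e : Fin ((i : ℕ) + 1 + 1) → placesOver F₀ p) (b₀ : Fin ((i : ℕ) + 1 + 1)),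
      ∀ ψ ∈ ind1StripOf (σ.lift (e b₀).1) (galoisLog (σ.lift (e b₀).1)), ∃ γ ∈ H ((i : ℕ) + 1) e,
        ∀ z : ∀ b, (σ.localFields p).k (e b),
          (γ : PacketAlgebra p (fun b => (σ.localFields p).k (e b)) ≃ₗ[ℚ_[p]]
              PacketAlgebra p (fun b => (σ.localFields p).k (e b))) (PiTensorProduct.tprod ℚ_[p] z) =
            PiTensorProduct.tprod ℚ_[p] (update z b₀
              (RescaledCompletion.of K p (σ.lift (e b₀).1) (σ.natCast_mem_lift (e b₀))
                (ψ ((RescaledCompletion.of K p (σ.lift (e b₀).1) (σ.natCast_mem_lift (e b₀))).symm (z b₀)))))) :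
    (realPrimePacketWith p (σ.localFields p) c hc0 hcσ).lnνLp lstar (fun j e =>
        packetHull p (fun b => (σ.localFields p).k (e b))
          (⋃ g : H j e, (g : PacketAlgebra p (fun b => (σ.localFields p).k (e b)) ≃ₗ[ℚ_[p]]
              PacketAlgebra p (fun b => (σ.localFields p).k (e b))) ''
            ⋃ τ : Equiv.Perm (Fin (j + 1)), (realPrimePacketWith p (σ.localFields p) c hc0 hcσ).perm τ e ''
              (realPrimePacketWith p (σ.localFields p) c hc0 hcσ).pilotRegion t j (e ∘ τ))) =
      (realPrimePacketWith p (σ.localFields p) c hc0 hcσ).negLogThetaAt lstar t := by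
  unfold PrimePacket.negLogThetaAt
  refine (realPrimePacketWith p (σ.localFields p) c hc0 hcσ).lnνLp_congr_of_succ lstar fun i e => ?_
  exact localFields_packetHull_orbitH_indOneUnion_pilotRegion_eq_possibleImagesHull_of_jannsenWingbergMappingClass σ p c hc0 hcσ hMC hp2 t i e
    (fun b => he (e b)) (fun b => h3 (e b)) (fun b => hodd (e b)) (fun b => hf (e b)) (H _ e) (hH _ e) (hstrip i e)

end PlaceSection

end Summit.ABC.IUTFork.Thm311.Real

/-! ## §4 Input level: the `p`-summand of `−|log(Θ)|` (reading (U)) of a genuine Θ-volume input -/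

namespace Literature.IUT.LogVolume.ThetaVolumeInput

open Summit.ABC.IUTFork.Thm311.Real Literature.NumberTheory.NumberFields Function

variable {F₀ : Type} [Field F₀] [NumberField F₀] {K : Type} [Field K] [NumberField K] [Algebra F₀ K]
variable (I : ThetaVolumeInput F₀ K)

/-- **INPUT LEVEL, reading (U).**  For a genuine Θ-volume input `I` and a prime `p > 2` over which every place of the section is tame of odd local degree
`≥ 3` with `f ≠ 1`: the `p`-summand of `−|log(Θ)|` (`negLogThetaLoc I p`, the cell's reading of record (U), Mochizuki's shell normalisation) EQUALS the
reading computed over any family `H` of subgroups of the packet automorphisms with `H ≤ indTwo` containing the single-factor (Ind1) strip moves — modulo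
`JannsenWingbergMappingClass`. [claim: Mochizuki2012, status: disputed] [cite: Mochizuki2012, IUTchIII Cor. 3.12 p. 174] [cite: DupuyHilado2025, §4.11, §4.12] -/
theorem lnνLp_hull_orbitH_indOneUnion_eq_negLogThetaLoc_of_jannsenWingbergMappingClass
    (hMC : Literature.AnabelianGeometry.AbsoluteAnabelian.JannsenWingbergMappingClass) {p : ℕ} (hp : p.Prime) (hp2 : 2 < p)
    (he : haveI : Fact p.Prime := ⟨hp⟩; ∀ v : placesOver F₀ p, absRamificationIdx p ((I.σ.localFields p).k v) ≤ p - 2)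
    (h3 : haveI : Fact p.Prime := ⟨hp⟩; ∀ v : placesOver F₀ p, 3 ≤ localDeg K (I.σ.lift v.1))
    (hodd : haveI : Fact p.Prime := ⟨hp⟩; ∀ v : placesOver F₀ p, Odd (localDeg K (I.σ.lift v.1)))
    (hf : haveI : Fact p.Prime := ⟨hp⟩; ∀ v : placesOver F₀ p, (I.σ.lift v.1).asIdeal.inertiaDeg ℤ ≠ 1)
    (H : haveI : Fact p.Prime := ⟨hp⟩
      (j : ℕ) → (e : Fin (j + 1) → placesOver F₀ p) →
        Subgroup (PacketAlgebra p (fun b => (I.σ.localFields p).k (e b)) ≃ₗ[ℚ_[p]]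
          PacketAlgebra p (fun b => (I.σ.localFields p).k (e b))))
    (hH : haveI : Fact p.Prime := ⟨hp⟩; ∀ j e, H j e ≤ indTwo p (fun b => (I.σ.localFields p).k (e b)))
    (hstrip : haveI : Fact p.Prime := ⟨hp⟩
      ∀ (i : Fin I.lstar) (e : Fin ((i : ℕ) + 1 + 1) → placesOver F₀ p) (b₀ : Fin ((i : ℕ) + 1 + 1)),
        ∀ ψ ∈ ind1StripOf (I.σ.lift (e b₀).1) (galoisLog (I.σ.lift (e b₀).1)), ∃ γ ∈ H ((i : ℕ) + 1) e,
          ∀ z : ∀ b, (I.σ.localFields p).k (e b),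
            (γ : PacketAlgebra p (fun b => (I.σ.localFields p).k (e b)) ≃ₗ[ℚ_[p]]
                PacketAlgebra p (fun b => (I.σ.localFields p).k (e b))) (PiTensorProduct.tprod ℚ_[p] z) =
              PiTensorProduct.tprod ℚ_[p] (update z b₀
                (RescaledCompletion.of K p (I.σ.lift (e b₀).1) (I.σ.natCast_mem_lift (e b₀))
                  (ψ ((RescaledCompletion.of K p (I.σ.lift (e b₀).1) (I.σ.natCast_mem_lift (e b₀))).symm (z b₀)))))) :
    haveI : Fact p.Prime := ⟨hp⟩
    (I.packetAt p hp).lnνLp I.lstar (fun j e =>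
        packetHull p (fun b => (I.σ.localFields p).k (e b))
          (⋃ g : H j e, (g : PacketAlgebra p (fun b => (I.σ.localFields p).k (e b)) ≃ₗ[ℚ_[p]]
              PacketAlgebra p (fun b => (I.σ.localFields p).k (e b))) ''
            ⋃ τ : Equiv.Perm (Fin (j + 1)), (I.packetAt p hp).perm τ e '' (I.packetAt p hp).pilotRegion (I.tΘ p hp) j (e ∘ τ))) =
      I.negLogThetaLoc p := by
  haveI : Fact p.Prime := ⟨hp⟩
  rw [negLogThetaLoc_of_prime I hp]
  exact localFields_lnνLp_hull_orbitH_indOneUnion_eq_negLogThetaAt_of_jannsenWingbergMappingClass I.σ p (mScale p (I.σ.localFields p))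
    (mScale_ne_zero p (I.σ.localFields p)) (mScale_perm p (I.σ.localFields p)) hMC hp2 (I.tΘ p hp) he h3 hodd hf H hH hstrip

end Literature.IUT.LogVolume.ThetaVolumeInput

end
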